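import Literature.MathematicalPhysics.QuantumFieldTheory.Balaban1983to89.T4TrajectoryDensity
import Summits.QuantumFields.BalabanUV.T4Continuum.Support.CovariantMeanRecursion

/-!
# T⁴ programme, spine estimate NE1′ (node O3b/H2) — THE EXPONENT SLICE FROM DEPTH-GAINED OLD PIECES: (w2-act)'s margin `s` as a
# HISTORY-INDEXED SUM under the (VAL-θ) hypothesis SHAPE (road P2's IDEATION OUTPUT No. 20, item (S3); NE1′ formalisation swarm
# row S9 «exponent-margin depth supplier — the (VAL-θ) SHAPE» of `t4/formal/NE1p/LEAVES.md`, BOOKED typer R-T53 (iv) → leaf-04 gen 2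
# on Q-leaf04g2-1, CLAIMS.log l.10951 ∕ l.11040)

Cell `pub-balaban`, sub-cell `t4`, BINDER-OWNERS row NE1′, formalisation swarm `b2b-balaban-t4-ne1p-formalise-*`, seat
`b2b-balaban-t4-ne1p-formalise-leaf-04` (gen 2).  ADDITIVE — imports the lineage's `T4TrajectoryDensity` (`ExponentSliceAt`, the
(w2-act) binder SHAPE of END-F's `hE`) and road P4's `Support/CovariantMeanRecursion` (the module DECLARING the disc lemma
`norm_le_div_of_disc`; it sits below `Support/CovariantMeanLatticeDepth` named in the booking, so the lower module is imported) ONLY;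
modifies nothing.  §1's two piece lemmas are ADAPTED (statements and proofs) from road P2 gen 34's SCRATCH kernel
`t4/b2b-balaban-t4-ne1p-p2-g34/work/NE1pThetaEscrowG34.Sketch.lean` §1–§2 (`piece_osc_le`, `piece_osc_le_depth`, `gained_modulus_le`;
planner-b2b-balaban-t4-ne1p-p2-g34-0, memo `t4/b2b-balaban-t4-ne1p-p2-g34/NE1p-ROUTES-g34.md` route R1 «θ-ESCROW») — credit theirs;
this file puts them on the fluctuation variable `z` (a.e.) and JOINS them to the tree's `ExponentSliceAt` BY NAME.

WHAT.  END-F's (w2-act) binder `hE : ExponentSliceAt (ref b k) (𝒜 b k) (μ b k) latMove latN (𝒦 b k′ (k+1)) w (ϱ b k′ k) (s b k)`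
asks, per met component, for ONE margin `s b k` bounding the oscillation of the action exponent along every admissible complex chart
move.  Road P2's route R1 proposes to READ that margin as a HISTORY-INDEXED SUM: the exponent at step `k` is the new step's own part
plus pieces CARRIED from their birth steps `j ≤ k` ([Balaban1989LargeFieldII] (1.69) p. 377, per-birth reading — a READING under
XREAD Q-age-0, not a fact), each piece analytic on its (thick) birth domain with sup `N_i`, and the VALUE MAP of the old layers moves,
under a current-scale chart move, by at most `c_V·θ_i·ρ_i` inside the room `ρ_i` left around the reference value ((VAL-θ): printed
TYPE [Balaban1985Variational] p. 307 «(δ∕δB)𝓗 has regularity and decay properties identical to the propagator»; its composition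
through [Balaban1989LargeFieldII] (1.61)–(1.63) is NOT printed — a NEW located estimate of road P2, DISPLAYED here as a binder).
Then the disc lemma gains the depth: each old piece oscillates by `≤ 2·N_i·(c_V θ_i)`, and
  `hE` holds with `s := s_new + Σ_{i ∈ I} 2·N_i·(c_V θ_i)`.
* §1 [arith∕Cauchy] `piece_osc_le`, `piece_osc_le_depth` (P2-g34's, on `norm_le_div_of_disc`), `pieces_osc_sum_le`.
* §2 [bookkeeping] **`exponentSliceAt_of_valDepth`** — THE JOIN: from the layered representation `𝒜 U z = 𝒜_new U z +
  Σ_{i∈I} t_i (val U i) z` (dictionary), the new part's own `ExponentSliceAt … s_new`, the pieces' a.e.-in-`z` analyticity ∕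
  measurability ∕ sups `N_i` on open birth domains `S_i` with rooms `ball (val (ref U₀) i) ρ_i ⊆ S_i`, and the (VAL-θ) SHAPE (along every
  admissible move `latMove U₀ p τ`, `τ` in an open `Ω ⊇` the closed `ϱ∕latN p`-balls about `[0,1]`: `τ ↦ val (latMove U₀ p τ) i`
  holomorphic and `‖val (latMove U₀ p τ) i − val (ref U₀) i‖ ≤ c_V·θ_i·ρ_i`, with `0 < c_V θ_i < 1`) — conclude VERBATIM the shape
  `ExponentSliceAt ref 𝒜 μ latMove latN 𝒦 w ϱ (s_new + Σ_{i∈I} 2·N_i·(c_V·θ_i))`.  The (VAL-θ) shape is written as an EXPLICIT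
  BINDER (no `def … : Prop` is minted, c3); road P2 may name it in its skeleton.
* §3 [arith] `margin_le_of_counts`: with `N_i ≤ N̄·n_i` (per-birth counts, (1.69)-TYPE) the margin is `≤ s_new + 2N̄c_V·Σ n_iθ_i` — the
  currency of road P2's escrow arithmetic (`run_charge_le` ∕ `lifetime_escrow_le` in the g34 scratch; (S4) is NOT typed here:
  `transportsFromVar_of_fam_capped` is not a tree object).

HEADLINE (c4, typer R-T53 condition (d)): «(w2-act) `hE` ⇐ ValDepthAt-data ∧ pieces analytic on birth domains (DISPLAYED) — mints no wall,
one level finer display; NE1′ NOT proved».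

HONEST FRAMING.  Rung (B)+1 bookkeeping on ONE finite four-torus of fixed physical size — NOT infinite volume, NOT a mass gap,
NOT OS on ℝ⁴, NOT the Clay problem, NOT summit progress.  NE1′ is NOT PRINTED and NOT PROVED; this file REFINES ONE DISPLAYED
wall binder ((w2-act) `hE`'s margin) into DISPLAYED history-indexed hypothesis shapes — it asserts none of them, decides nothing about
THE NUMBER `s̄⁰ < 1` (`hs₀`), and instantiates nothing on Bałaban's densities; (VAL-θ) is road P2's NEW located estimate (WALL v2.1
§0), the per-birth reading of (1.69) is under XREAD (Q-age-0).  [folklore] one-variable Cauchy∕Schwarz + triangle inequality + kernel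
glue, 0 sorry, 0 citations used as hypothesis-free facts, 0 `def … : Prop`.  Spine PROVED 0∕9 unchanged.  HONEST DEPENDENCY:
continuum YM on T⁴ ⇐ BetaPertH ∧ nine spine estimates (0/9 proved); BetaPertH ⇐ (D1) ∧ (D4) ∧ CAP+tail; G-an2-4 gates asym, D1 and
NE2/3/4.
-/

noncomputable section

namespace Summit.QuantumFields.BalabanUV.T4Continuum.NE1p.DressedExponentDepth

open MeasureTheory Set Metric Finset
open scoped BigOperators
open Literature.MathematicalPhysics.QuantumFieldTheory.Balaban1983to89
open T4BlockTransport (Fld NDir latMove latN)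
open T4TrajectoryDensity
open Summit.QuantumFields.BalabanUV.T4Continuum.CovariantMeanRecursion (norm_le_div_of_disc)

variable {E : Type*} [NormedAddCommGroup E] [NormedSpace ℂ E]
variable {F : Type*} [NormedAddCommGroup F] [NormedSpace ℂ F]

/-! ## §1 One old piece along the actual value displacement (road P2 gen 34's piece lemmas, adapted) -/

/-- [Cauchy] [folklore] ONE OLD PIECE (P2-g34 `piece_osc_le`, adapted): `t` analytic on its open birth domain `S` with `‖t‖ ≤ N`
there; if `ball V₀ R ⊆ S` and the displacement `D` satisfies `‖D‖·Λ ≤ R` with `Λ > 1`, then `‖t (V₀ + D) − t V₀‖ ≤ 2N∕Λ` — the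
disc lemma `CovariantMeanRecursion.norm_le_div_of_disc` on the affine disc `ζ ↦ V₀ + ζ•D` through `V₀`. -/
theorem piece_osc_le {t : E → F} {S : Set E} {V₀ D : E} {Λ N R : ℝ} (hΛ : 1 < Λ) (hS : IsOpen S)
    (ht : DifferentiableOn ℂ t S) (hN : ∀ V ∈ S, ‖t V‖ ≤ N) (hR : 0 < R) (hball : ball V₀ R ⊆ S)
    (hD : ‖D‖ * Λ ≤ R) : ‖t (V₀ + D) - t V₀‖ ≤ 2 * N / Λ := by
  -- adapted from t4/b2b-balaban-t4-ne1p-p2-g34/work/NE1pThetaEscrowG34.Sketch.lean §1 (road P2 gen 34)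
  have hV₀ : V₀ ∈ S := hball (mem_ball_self hR)
  set ψ : ℂ → E := fun ζ => V₀ + ζ • D with hψ
  have hψd : Differentiable ℂ ψ := by
    intro ζ
    simp only [hψ]
    fun_prop
  have hmaps : MapsTo ψ (ball (0 : ℂ) Λ) S := by
    intro ζ hζ
    apply hball
    rw [mem_ball, dist_eq_norm]
    simp only [hψ, add_sub_cancel_left, norm_smul]
    rw [mem_ball, dist_zero_right] at hζ
    rcases eq_or_lt_of_le (norm_nonneg D) with h0 | hpos
    · rw [← h0, mul_zero]; exact hR
    · calc ‖ζ‖ * ‖D‖ < Λ * ‖D‖ := mul_lt_mul_of_pos_right hζ hpos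
        _ = ‖D‖ * Λ := mul_comm _ _
        _ ≤ R := hD
  have hΦ : DifferentiableOn ℂ (fun V => t V - t V₀) S := ht.sub_const _
  have hN2 : ∀ V ∈ S, ‖(fun V => t V - t V₀) V‖ ≤ 2 * N := by
    intro V hV
    calc ‖t V - t V₀‖ ≤ ‖t V‖ + ‖t V₀‖ := norm_sub_le _ _
      _ ≤ N + N := add_le_add (hN V hV) (hN V₀ hV₀)
      _ = 2 * N := by ring
  have h0 : (fun V => t V - t V₀) (ψ 0) = 0 := by simp [hψ]
  have h := norm_le_div_of_disc hΛ hS hΦ hN2 hψd hmaps h0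
  simpa [hψ] using h

/-- [Cauchy] [folklore] DEPTH FORM (P2-g34 `piece_osc_le_depth`, adapted): under the (VAL-θ)-type displacement bound
`‖D‖ ≤ c_V·θ·ρ` with room `ball V₀ ρ ⊆ S` and `0 < c_V θ < 1`, the piece varies by `≤ 2N·(c_V θ)`. -/
theorem piece_osc_le_depth {t : E → F} {S : Set E} {V₀ D : E} {N ρ cV θ : ℝ} (hS : IsOpen S)
    (ht : DifferentiableOn ℂ t S) (hN : ∀ V ∈ S, ‖t V‖ ≤ N) (hρ : 0 < ρ) (hroom : ball V₀ ρ ⊆ S)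
    (hval : ‖D‖ ≤ cV * θ * ρ) (hq0 : 0 < cV * θ) (hq1 : cV * θ < 1) :
    ‖t (V₀ + D) - t V₀‖ ≤ 2 * N * (cV * θ) := by
  -- adapted from t4/b2b-balaban-t4-ne1p-p2-g34/work/NE1pThetaEscrowG34.Sketch.lean §1 (road P2 gen 34)
  have hΛ : 1 < (cV * θ)⁻¹ := (one_lt_inv₀ hq0).2 hq1
  have hD : ‖D‖ * (cV * θ)⁻¹ ≤ ρ := by
    rw [mul_inv_le_iff₀ hq0]
    calc ‖D‖ ≤ cV * θ * ρ := hval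
      _ = ρ * (cV * θ) := by ring
  have h := piece_osc_le hΛ hS ht hN hρ hroom hD
  rwa [div_inv_eq_mul] at h

/-- [arith] [folklore] THE GAINED SUM (P2-g34 `gained_modulus_le`, adapted): finitely many old pieces, each with its own birth
domain, sup, room and depth — `‖Σ t_i (V₀ i + D i) − Σ t_i (V₀ i)‖ ≤ Σ 2·N_i·(c_V θ_i)`. -/
theorem pieces_osc_sum_le {ι : Type*} (I : Finset ι) {t : ι → E → F} {S : ι → Set E} {V₀ D : ι → E}
    {N ρ θ : ι → ℝ} {cV : ℝ} (hS : ∀ i ∈ I, IsOpen (S i)) (ht : ∀ i ∈ I, DifferentiableOn ℂ (t i) (S i))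
    (hN : ∀ i ∈ I, ∀ V ∈ S i, ‖t i V‖ ≤ N i) (hρ : ∀ i ∈ I, 0 < ρ i)
    (hroom : ∀ i ∈ I, ball (V₀ i) (ρ i) ⊆ S i) (hval : ∀ i ∈ I, ‖D i‖ ≤ cV * θ i * ρ i)
    (hq0 : ∀ i ∈ I, 0 < cV * θ i) (hq1 : ∀ i ∈ I, cV * θ i < 1) :
    ‖∑ i ∈ I, t i (V₀ i + D i) - ∑ i ∈ I, t i (V₀ i)‖ ≤ ∑ i ∈ I, 2 * N i * (cV * θ i) := by
  rw [← Finset.sum_sub_distrib]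
  exact norm_sum_le_of_le I fun i hi =>
    piece_osc_le_depth (hS i hi) (ht i hi) (hN i hi) (hρ i hi) (hroom i hi) (hval i hi) (hq0 i hi) (hq1 i hi)

/-! ## §2 The join: `ExponentSliceAt` with a history-indexed margin from the (VAL-θ) shape -/

section Join

variable {R : Type*} [NormedRing R] [NormedAlgebra ℂ R] {d : ℕ}
variable {Z : Type*} [MeasurableSpace Z] {ι : Type*}

/-- **THE (w2-act) EXPONENT SLICE WITH A HISTORY-INDEXED MARGIN** [bookkeeping].  Data per met component: the action exponent `𝒜`
written as the NEW step's part `𝒜new` plus finitely many OLD PIECES `t i` evaluated at the layer values `val U i` (DICTIONARY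
`h𝒜`, never asserted for Bałaban's densities); the new part's own slice `hnew : ExponentSliceAt ref 𝒜new … snew`; for every piece an
open birth domain `S i` on which, for a.e. fluctuation `z`, `V ↦ t i V z` is holomorphic with sup `≤ N i` ((1.69)-TYPE per-birth
reading), `z ↦ t i V z` a.e.-strongly measurable for `V ∈ S i`, and ROOM `ball (val (ref U₀) i) (ρ i) ⊆ S i` about the reference
value of every window point; and THE (VAL-θ) SHAPE `hval` (DISPLAYED — road P2's new located estimate, NOT printed as stated, NOT
asserted): along every admissible chart move `latMove U₀ p τ` (`U₀ ∈ 𝒦`, `0 < latN p ≤ w`), for `τ` in an open `Ω` containing the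
closed `ϱ∕latN p`-balls about `[0,1]`, each `τ ↦ val (latMove U₀ p τ) i` is holomorphic and stays within `c_V·θ_i·ρ_i` of
`val (ref U₀) i`, where `0 < c_V θ_i < 1`.  CONCLUSION: VERBATIM the (w2-act) binder shape of END-F's `hE`,
`ExponentSliceAt ref 𝒜 μ latMove latN 𝒦 w ϱ (snew + Σ_{i∈I} 2·N_i·(c_V·θ_i))`. [folklore] -/
theorem exponentSliceAt_of_valDepth {ref : Fld d R → Fld d R} {𝒜 𝒜new : Fld d R → Z → ℂ} {μ : Measure Z}
    {𝒦 : Set (Fld d R)} {w ϱ snew cV : ℝ} (I : Finset ι) {val : Fld d R → ι → E} {t : ι → E → Z → ℂ}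
    {S : ι → Set E} {N θ ρ : ι → ℝ}
    (h𝒜 : ∀ U z, 𝒜 U z = 𝒜new U z + ∑ i ∈ I, t i (val U i) z)
    (hnew : ExponentSliceAt ref 𝒜new μ latMove latN 𝒦 w ϱ snew)
    (hS : ∀ i ∈ I, IsOpen (S i))
    (ht : ∀ i ∈ I, ∀ᵐ z ∂μ, DifferentiableOn ℂ (fun V => t i V z) (S i))
    (htm : ∀ i ∈ I, ∀ V ∈ S i, AEStronglyMeasurable (fun z => t i V z) μ)
    (hN : ∀ i ∈ I, ∀ᵐ z ∂μ, ∀ V ∈ S i, ‖t i V z‖ ≤ N i)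
    (hρ : ∀ i ∈ I, 0 < ρ i)
    (hroom : ∀ i ∈ I, ∀ U₀ ∈ 𝒦, ball (val (ref U₀) i) (ρ i) ⊆ S i)
    (hval : ∀ U₀ ∈ 𝒦, ∀ p : NDir d R, 0 < latN p → latN p ≤ w →
      ∃ Ω : Set ℂ, IsOpen Ω ∧ (∀ x ∈ Icc (0 : ℝ) 1, closedBall (x : ℂ) (ϱ / latN p) ⊆ Ω) ∧
        ∀ i ∈ I, DifferentiableOn ℂ (fun τ => val (latMove U₀ p τ) i) Ω ∧
          ∀ τ ∈ Ω, ‖val (latMove U₀ p τ) i - val (ref U₀) i‖ ≤ cV * θ i * ρ i)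
    (hq0 : ∀ i ∈ I, 0 < cV * θ i) (hq1 : ∀ i ∈ I, cV * θ i < 1) :
    ExponentSliceAt ref 𝒜 μ latMove latN 𝒦 w ϱ (snew + ∑ i ∈ I, 2 * N i * (cV * θ i)) := by
  intro U₀ hU₀ p hp hpw
  obtain ⟨Ω₁, hΩ₁, hballs₁, hm₁, hd₁, hb₁⟩ := hnew U₀ hU₀ p hp hpw
  obtain ⟨Ω₂, hΩ₂, hballs₂, hval₂⟩ := hval U₀ hU₀ p hp hpw
  -- the layer values along the move stay inside the birth domains
  have hin : ∀ i ∈ I, ∀ τ ∈ Ω₂, val (latMove U₀ p τ) i ∈ S i := by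
    intro i hi τ hτ
    apply hroom i hi U₀ hU₀
    rw [mem_ball, dist_eq_norm]
    have h1 := (hval₂ i hi).2 τ hτ
    have h2 : cV * θ i * ρ i < ρ i := by
      have := mul_lt_mul_of_pos_right (hq1 i hi) (hρ i hi)
      simpa using this
    exact lt_of_le_of_lt h1 h2
  refine ⟨Ω₁ ∩ Ω₂, hΩ₁.inter hΩ₂, fun x hx => subset_inter (hballs₁ x hx) (hballs₂ x hx), ?_, ?_, ?_⟩
  · -- measurability of the total exponent at every chart point of Ω
    intro τ hτ
    have e : 𝒜 (latMove U₀ p τ) = fun z => 𝒜new (latMove U₀ p τ) z + ∑ i ∈ I, t i (val (latMove U₀ p τ) i) z :=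
      funext fun z => h𝒜 _ z
    rw [e]
    exact (hm₁ τ hτ.1).add
      (Finset.aestronglyMeasurable_fun_sum I fun i hi => htm i hi _ (hin i hi τ hτ.2))
  · -- a.e. holomorphy in the chart parameter on Ω
    have hall : ∀ᵐ z ∂μ, ∀ i ∈ I, DifferentiableOn ℂ (fun V => t i V z) (S i) :=
      (Finset.eventually_all I).2 fun i hi => ht i hi
    filter_upwards [hd₁, hall] with z hz hz'
    have e : (fun τ => 𝒜 (latMove U₀ p τ) z) =
        fun τ => 𝒜new (latMove U₀ p τ) z + ∑ i ∈ I, t i (val (latMove U₀ p τ) i) z :=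
      funext fun τ => h𝒜 _ z
    rw [e]
    refine (hz.mono inter_subset_left).add (DifferentiableOn.fun_sum fun i hi => ?_)
    exact ((hz' i hi).comp ((hval₂ i hi).1.mono inter_subset_right)
      (fun τ hτ => hin i hi τ hτ.2))
  · -- the oscillation bound: new part + depth-gained old pieces
    have hall : ∀ᵐ z ∂μ, ∀ i ∈ I, DifferentiableOn ℂ (fun V => t i V z) (S i) :=
      (Finset.eventually_all I).2 fun i hi => ht i hi
    have hallN : ∀ᵐ z ∂μ, ∀ i ∈ I, ∀ V ∈ S i, ‖t i V z‖ ≤ N i :=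
      (Finset.eventually_all I).2 fun i hi => hN i hi
    filter_upwards [hb₁, hall, hallN] with z hz hz' hzN
    intro τ hτ
    have e1 : 𝒜 (latMove U₀ p τ) z - 𝒜 (ref U₀) z =
        (𝒜new (latMove U₀ p τ) z - 𝒜new (ref U₀) z) +
          (∑ i ∈ I, t i (val (ref U₀) i + (val (latMove U₀ p τ) i - val (ref U₀) i)) z -
            ∑ i ∈ I, t i (val (ref U₀) i) z) := by
      rw [h𝒜, h𝒜]
      simp only [add_sub_cancel]
      ring
    rw [e1]
    refine (norm_add_le _ _).trans (add_le_add (hz τ hτ.1) ?_)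
    exact pieces_osc_sum_le I (t := fun i V => t i V z) (S := S) (V₀ := fun i => val (ref U₀) i)
      (D := fun i => val (latMove U₀ p τ) i - val (ref U₀) i) hS hz' hzN hρ
      (fun i hi => hroom i hi U₀ hU₀) (fun i hi => (hval₂ i hi).2 τ hτ.2) hq0 hq1

end Join

/-! ## §3 The margin in the escrow currency -/

/-- [arith] [folklore] With per-birth counts `N_i ≤ N̄·n_i` ((1.69)-TYPE: `n_i = |Γ_{j_i} ∩ Y|`, `N̄ = O(1)` — DISPLAYED, not
asserted) and `0 ≤ c_V θ_i`, the history-indexed margin is `≤ s_new + 2·N̄·c_V·Σ_i n_i·θ_i` — the currency in which road P2's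
escrow arithmetic (`run_charge_le` ∕ `lifetime_escrow_le`, g34 scratch) sums the depth-gained charges over a family's life. -/
theorem margin_le_of_counts {ι : Type*} (I : Finset ι) {N θ n : ι → ℝ} {snew cV Nbar : ℝ}
    (hNn : ∀ i ∈ I, N i ≤ Nbar * n i) (hθ : ∀ i ∈ I, 0 ≤ cV * θ i) :
    snew + ∑ i ∈ I, 2 * N i * (cV * θ i) ≤ snew + 2 * Nbar * cV * ∑ i ∈ I, n i * θ i := by
  have h : ∑ i ∈ I, 2 * N i * (cV * θ i) ≤ ∑ i ∈ I, 2 * Nbar * cV * (n i * θ i) :=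
    Finset.sum_le_sum fun i hi => by
      have := mul_le_mul_of_nonneg_right (hNn i hi) (hθ i hi)
      nlinarith
  rw [← Finset.mul_sum] at h
  linarith

end Summit.QuantumFields.BalabanUV.T4Continuum.NE1p.DressedExponentDepth

end
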